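import Literature.Probability.LatticeModels.HexONTransferMatrix
import HarnessLib

/-!
# The honeycomb `O(n)` strip transfer matrix: the fully packed sector and the width-one strip

Closed-form evaluations of the definitions of `HexONTransferMatrix.lean` (definition request
`defn-HexONTransferMatrix`, routes `CriticalPhenomena/SAWScalingLimit/SAWBetheAnsatz`,
`SAWLatticeVirasoro`), recorded as checks of those definitions and as the first explicit matrix
elements available to the routes.

## The fully packed sector (any width `T`)

With all `T` cut edges carrying defects on both sides of a column (`DiluteLink.full T`, sector
`k = T`: `T` mutually avoiding through-lines filling the strip), the only compatible column
configuration is the all-rungs one (`rungs T`: every vertex pair `U_i — D_i` a strand; proved in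
`eq_rungs_of_compatible` — every level must be a strand end, strands are then single edges, and the
perfect matching of the column path into edges is forced from level `0` upwards), it visits all
`2T` vertices and closes no loop, so `transferMatrix_full_full : 𝐓 (full) (full) = x^{2T}` and, the
sector being one state (`eq_full_of_defects_eq`), `sectorTM_top_pow_apply : (𝐓_{k=T})^m = x^{2Tm}`.

## Width one (`T = 1`)

The strip of width `1` has the two levels `0` (`U₀`) and `1` (`D₀`) per column, one cut edge
`D₀(c) — U₀(c+1)` between consecutive columns, and hence is the doubly infinite PATH
`⋯ U₀(0) D₀(0) U₀(1) D₀(1) ⋯`; the link states on one node are the vacuum and the single defect.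

* `transferMatrix_one_single_single`: the one-defect entry is `x²` (the rung `U₀ — D₀`, two
  vertices, no loop); with `transferMatrix_vacuum_vacuum` and the block structure the width-one
  transfer matrix is `diag(1, x²)` (`transferMatrix_one`).
* `sawIn_one_single = sawOut_one_single = x + x²` (the walk starts at `D₀(0)` and leaves at once, or
  starts at `U₀(0)` and runs the rung; symmetrically at the end).
* `polymerPF_one`: `polymerPF R 1 n x m = (x + x²)² · x^{2m}` for every loop weight `n`.

This is the value of the one-walk strip partition function `W(1, N)`, `N = m + 1`, of
`SAWBetheAnsatz.StripRateExists` computed by hand: in the path `U₀(0) D₀(0) ⋯ U₀(N) D₀(N)` the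
self-avoiding walks from column `0` to column `N` are the four segments from `U₀(0)` or `D₀(0)` to
`U₀(N)` or `D₀(N)`, with `2N+2, 2N+1, 2N+1, 2N` vertices, so `W(1,N) = x^{2N}(1+x)² =
(x+x²)² x^{2(N-1)}` — the width-one case of the sanity identity `polymerPF T 0 x (N-1) = W(T,N)`
recorded (unproved in general) in `HexONTransferMatrix.lean`.

## References

* J. L. Jacobsen, *Conformal field theory applied to loop models*, in: Polygons, Polyominoes and
  Polycubes, LNP 775 (2009), §14.7.2 (transfer matrices on connectivity states with `ℓ` strings,
  `Z = ⟨v|T^M|u⟩`; the number of strings is conserved sector by sector).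
-/

noncomputable section

open Finset Matrix

namespace Literature.Probability.LatticeModels

namespace HexON

/-! ### Generic tools: reachability invariants and the absence of closed loops -/

/-- A function constant along edges is constant along reachability. [folklore] -/
theorem reachable_invariant {V α : Type*} {G : SimpleGraph V} (f : V → α)
    (hf : ∀ v w, G.Adj v w → f v = f w) {v w : V} (h : G.Reachable v w) : f v = f w := by
  obtain ⟨p⟩ := h
  induction p with
  | nil => rfl
  | cons ha _ ih => exact (hf _ _ ha).trans ih

variable {T : ℕ}

/-- A component containing a vertex with exactly one neighbour is not a closed loop. [folklore] -/
theorem not_isLoop_of_adj_iff_eq {G : SimpleGraph (Node T)} (v a : Node T)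
    (h : ∀ w, G.Adj v w ↔ w = a) : ¬ IsLoop G (G.connectedComponentMk v) := by
  intro hl
  obtain ⟨a', b', hne, hab⟩ := hl v rfl
  have ha' : a' = a := (h a').1 ((hab a').2 (Or.inl rfl))
  have hb' : b' = a := (h b').1 ((hab b').2 (Or.inr rfl))
  exact hne (ha'.trans hb'.symm)

/-- A component containing an isolated vertex is not a closed loop. [folklore] -/
theorem not_isLoop_of_not_adj {G : SimpleGraph (Node T)} (v : Node T) (h : ∀ w, ¬ G.Adj v w) :
    ¬ IsLoop G (G.connectedComponentMk v) := by
  intro hl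
  obtain ⟨a, b, -, hab⟩ := hl v rfl
  exact h a ((hab a).2 (Or.inl rfl))

/-- The component of a neighbour is the same component. [folklore] -/
theorem not_isLoop_of_adj {G : SimpleGraph (Node T)} {v u : Node T} (huv : G.Adj u v)
    (h : ¬ IsLoop G (G.connectedComponentMk u)) : ¬ IsLoop G (G.connectedComponentMk v) := by
  rwa [← SimpleGraph.ConnectedComponent.eq.2 huv.symm.reachable] at h

/-- If no component is a closed loop, `loops = 0`. [folklore] -/
theorem loops_eq_zero {G : SimpleGraph (Node T)} (h : ∀ v, ¬ IsLoop G (G.connectedComponentMk v)) :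
    loops G = 0 := by
  rw [loops, Nat.card_eq_zero]
  left
  refine ⟨fun ⟨c, hc⟩ => ?_⟩
  induction c using SimpleGraph.ConnectedComponent.ind with
  | h v => exact h v hc

/-! ### Generic tools: isolated vertices of a glued graph -/

/-- A strand not in the configuration is isolated. [folklore] -/
theorem not_adj_strand_of_notMem (σ : DiluteLink T) {γ : Finset (Level T × Level T)}
    (h : Option (Level T × Level T × Bool)) {p : Level T × Level T} (hp : p ∉ γ) (w : Node T) :
    ¬ (glue σ γ h).Adj (.strand p) w := by
  rw [glue, SimpleGraph.fromRel_adj]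
  cases w <;> simp [glueRel, hp]

/-- An arc vertex `(i, j)` not listed increasingly is isolated. [folklore] -/
theorem not_adj_arcN_of_not_lt (σ : DiluteLink T) (γ : Finset (Level T × Level T))
    (h : Option (Level T × Level T × Bool)) {q : Fin T × Fin T} (hq : ¬ q.1 < q.2) (w : Node T) :
    ¬ (glue σ γ h).Adj (.arcN q) w := by
  rw [glue, SimpleGraph.fromRel_adj]
  cases w <;> simp [glueRel, hq]

/-- An arc vertex that is not an arc of the incoming state is isolated. [folklore] -/
theorem not_adj_arcN_of_slot_ne (σ : DiluteLink T) (γ : Finset (Level T × Level T))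
    (h : Option (Level T × Level T × Bool)) {q : Fin T × Fin T} (hq : σ.slot q.1 ≠ .arc q.2)
    (w : Node T) : ¬ (glue σ γ h).Adj (.arcN q) w := by
  rw [glue, SimpleGraph.fromRel_adj]
  cases w <;> simp [glueRel, hq]

/-- Without a half-strand, `half` is isolated. [folklore] -/
theorem not_adj_half_none (σ : DiluteLink T) (γ : Finset (Level T × Level T)) (w : Node T) :
    ¬ (glue σ γ none).Adj .half w := by
  rw [glue, SimpleGraph.fromRel_adj]
  cases w <;> simp [glueRel]

/-- Without a half-strand, `term` is isolated. [folklore] -/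
theorem not_adj_term_none (σ : DiluteLink T) (γ : Finset (Level T × Level T)) (w : Node T) :
    ¬ (glue σ γ none).Adj .term w := by
  rw [glue, SimpleGraph.fromRel_adj]
  cases w <;> simp [glueRel]

/-- Every edge of a glued graph has a port as an end, or joins `half` and `term`. [folklore] -/
theorem glue_adj_cases {σ : DiluteLink T} {γ : Finset (Level T × Level T)}
    {h : Option (Level T × Level T × Bool)} {v w : Node T} (hvw : (glue σ γ h).Adj v w) :
    (∃ m, v = .port m) ∨ (∃ m, w = .port m) ∨ (v = .half ∧ w = .term) ∨ (v = .term ∧ w = .half) := by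
  rw [glue, SimpleGraph.fromRel_adj] at hvw
  obtain ⟨-, hvw | hvw⟩ := hvw <;> cases v <;> cases w <;> simp [glueRel] at hvw ⊢

/-! ### The node of a level; every level is a port -/

/-- The node index of a level: `U_i` (level `2i`) and `D_i` (level `2i+1`) `↦ i`. [folklore] -/
def nodeOf (m : Level T) : Fin T := ⟨m.val / 2, by omega⟩

/-- `nodeOf` in coordinates. [folklore] -/
@[simp] theorem nodeOf_val (m : Level T) : (nodeOf m).val = m.val / 2 := rfl

/-- The node of an in-port. [folklore] -/
@[simp] theorem nodeOf_inLevel (i : Fin T) : nodeOf (inLevel i) = i :=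
  Fin.ext (by simp only [nodeOf_val, inLevel_val]; omega)

/-- The node of an out-port. [folklore] -/
@[simp] theorem nodeOf_outLevel (i : Fin T) : nodeOf (outLevel i) = i :=
  Fin.ext (by simp only [nodeOf_val, outLevel_val]; omega)

/-- Every level is the in-port or the out-port of its node. [folklore] -/
theorem level_eq_in_or_out (m : Level T) : m = inLevel (nodeOf m) ∨ m = outLevel (nodeOf m) := by
  rcases Nat.even_or_odd m.val with ⟨k, hk⟩ | ⟨k, hk⟩
  · left; exact Fin.ext (by simp only [inLevel_val, nodeOf_val]; omega)
  · right; exact Fin.ext (by simp only [outLevel_val, nodeOf_val]; omega)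

/-! ### The fully packed sector (`k = T`): every column is all rungs -/

/-- **The rung configuration**: every vertex pair `U_i — D_i` of the column is a strand (all `T`
through-lines cross the column straight). [folklore] -/
def rungs (T : ℕ) : Finset (Level T × Level T) := univ.image fun i : Fin T => (inLevel i, outLevel i)

/-- Membership in `rungs`. [folklore] -/
theorem mem_rungs {p : Level T × Level T} : p ∈ rungs T ↔ ∃ i, p = (inLevel i, outLevel i) := by
  simp only [rungs, mem_image, mem_univ, true_and]
  exact ⟨fun ⟨i, hi⟩ => ⟨i, hi.symm⟩, fun ⟨i, hi⟩ => ⟨i, hi.symm⟩⟩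

/-- Each rung is a rung. [folklore] -/
theorem rung_mem_rungs (i : Fin T) : (inLevel i, outLevel i) ∈ rungs T := mem_rungs.2 ⟨i, rfl⟩

/-- The rungs form a column configuration. [folklore] -/
theorem rungs_mem_colConfigs : rungs T ∈ colConfigs T := by
  rw [mem_colConfigs_iff]
  constructor
  · intro p hp
    obtain ⟨i, rfl⟩ := mem_rungs.1 hp
    show inLevel i < outLevel i
    rw [Fin.lt_def, inLevel_val, outLevel_val]
    omega
  · intro p hp q hq hpq
    obtain ⟨i, rfl⟩ := mem_rungs.1 hp
    obtain ⟨j, rfl⟩ := mem_rungs.1 hq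
    have hij : i.val ≠ j.val := fun h => hpq (by rw [Fin.ext h])
    rcases Nat.lt_or_gt_of_ne hij with h | h
    · left
      show outLevel i < inLevel j
      rw [Fin.lt_def, inLevel_val, outLevel_val]
      omega
    · right
      show outLevel j < inLevel i
      rw [Fin.lt_def, inLevel_val, outLevel_val]
      omega

/-- The rungs visit all `2T` vertices of the column. [folklore] -/
theorem verts_rungs : verts (rungs T) = 2 * T := by
  rw [verts, rungs, sum_image]
  · simp only [outLevel_val, inLevel_val]
    rw [sum_congr rfl fun i _ => show 2 * (i : Fin T).val + 1 - 2 * i.val + 1 = 2 by omega]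
    simp [mul_comm]
  · intro i _ j _ h
    have := congrArg (fun p : Level T × Level T => p.1.val) h
    simp only [inLevel_val] at this
    exact Fin.ext (by omega)

/-- The rungs use every port. [folklore] -/
theorem mem_used_rungs (m : Level T) : m ∈ used (rungs T) := by
  rw [used, mem_biUnion]
  refine ⟨(inLevel (nodeOf m), outLevel (nodeOf m)), rung_mem_rungs _, ?_⟩
  rw [mem_insert, mem_singleton]
  exact level_eq_in_or_out m

/-- In the all-rungs column glued to the all-defect state, the only neighbour of a port is its
rung. [folklore] -/
theorem full_rungs_adj_port_iff (m : Level T) (w : Node T) :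
    (glue (DiluteLink.full T) (rungs T) none).Adj (.port m) w ↔
      w = .strand (inLevel (nodeOf m), outLevel (nodeOf m)) := by
  rw [glue, SimpleGraph.fromRel_adj]
  cases w with
  | port m' => simp [glueRel]
  | strand p =>
    simp only [ne_eq, reduceCtorEq, not_false_eq_true, true_and, glueRel, or_false, Node.strand.injEq,
      mem_rungs]
    constructor
    · rintro ⟨⟨i, rfl⟩, hm | hm⟩ <;> subst hm <;> simp
    · rintro rfl
      exact ⟨⟨_, rfl⟩, level_eq_in_or_out m⟩
  | arcN q => simp [glueRel]
  | half => simp [glueRel]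
  | term => simp [glueRel]

/-- The node index is constant on the connected components of that glued graph (ports and listed
strands carry their node, everything else is isolated). [folklore] -/
theorem full_rungs_reachable_nodeOf {m m' : Level T}
    (h : (glue (DiluteLink.full T) (rungs T) none).Reachable (.port m) (.port m')) :
    nodeOf m = nodeOf m' := by
  let f : Node T → Option (Fin T)
    | .port m => some (nodeOf m)
    | .strand p => some (nodeOf p.1)
    | _ => none
  have key : ∀ m w, (glue (DiluteLink.full T) (rungs T) none).Adj (.port m) w → f (.port m) = f w := by
    intro m w hw
    rw [full_rungs_adj_port_iff] at hw
    subst hw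
    simp [f]
  have hf : ∀ v w, (glue (DiluteLink.full T) (rungs T) none).Adj v w → f v = f w := by
    intro v w hvw
    rcases glue_adj_cases hvw with ⟨m, rfl⟩ | ⟨m, rfl⟩ | ⟨rfl, rfl⟩ | ⟨rfl, rfl⟩
    · exact key m w hvw
    · exact (key m v hvw.symm).symm
    · exact absurd hvw (not_adj_half_none _ _ _)
    · exact absurd hvw (not_adj_term_none _ _ _)
  simpa [f] using reachable_invariant f hf h

/-- The two ports of a node are joined by its rung. [folklore] -/
theorem full_rungs_reachable (i : Fin T) :
    (glue (DiluteLink.full T) (rungs T) none).Reachable (.port (outLevel i)) (.port (inLevel i)) := by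
  have h1 : (glue (DiluteLink.full T) (rungs T) none).Adj (.port (outLevel i))
      (.strand (inLevel i, outLevel i)) := (full_rungs_adj_port_iff _ _).2 (by simp)
  have h2 : (glue (DiluteLink.full T) (rungs T) none).Adj (.port (inLevel i))
      (.strand (inLevel i, outLevel i)) := (full_rungs_adj_port_iff _ _).2 (by simp)
  exact h1.reachable.trans h2.symm.reachable

/-- **The all-rungs column is compatible with the all-defect state on both cuts.** [folklore] -/
theorem compatible_full_rungs : Compatible (DiluteLink.full T) (rungs T) (DiluteLink.full T) where
  in_used i := by simp [mem_used_rungs, DiluteLink.occ]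
  out_used e := by simp [mem_used_rungs, DiluteLink.occ]
  defects_apart i j _ _ hij hr := hij (by simpa using full_rungs_reachable_nodeOf hr)
  arc_iff e f := by
    simp only [DiluteLink.full_slot, reduceCtorEq, false_iff, not_and]
    exact fun hef hr => hef (by simpa using full_rungs_reachable_nodeOf hr)
  defect_iff e := by
    simp only [DiluteLink.IsDefect, DiluteLink.full_slot, true_and, true_iff]
    exact ⟨e, full_rungs_reachable e⟩
  through i _ := ⟨i, (full_rungs_reachable i).symm⟩

/-- The all-rungs column closes no loop. [folklore] -/
theorem loops_full_rungs : loops (glue (DiluteLink.full T) (rungs T) none) = 0 := by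
  refine loops_eq_zero fun v => ?_
  have hport : ∀ m, ¬ IsLoop (glue (DiluteLink.full T) (rungs T) none)
      ((glue (DiluteLink.full T) (rungs T) none).connectedComponentMk (.port m)) :=
    fun m => not_isLoop_of_adj_iff_eq _ _ (full_rungs_adj_port_iff m)
  cases v with
  | port m => exact hport m
  | strand p =>
    by_cases hp : p ∈ rungs T
    · obtain ⟨i, rfl⟩ := mem_rungs.1 hp
      exact not_isLoop_of_adj ((full_rungs_adj_port_iff (inLevel i) _).2 (by simp)) (hport _)
    · exact not_isLoop_of_not_adj _ (not_adj_strand_of_notMem _ none hp)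
  | arcN q => exact not_isLoop_of_not_adj _ (not_adj_arcN_of_slot_ne _ _ none (by simp))
  | half => exact not_isLoop_of_not_adj _ (not_adj_half_none _ _)
  | term => exact not_isLoop_of_not_adj _ (not_adj_term_none _ _)

/-- **Uniqueness**: a column configuration compatible with the all-defect state on both cuts is the
all-rungs configuration (every level must be a strand end; strands are then single edges, and the
matching of the path `0 — 1 — ⋯ — (2T-1)` into edges starting at level `0` is forced). [folklore] -/
theorem eq_rungs_of_compatible {γ : Finset (Level T × Level T)} (hγ : γ ∈ colConfigs T)
    (hc : Compatible (DiluteLink.full T) γ (DiluteLink.full T)) : γ = rungs T := by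
  obtain ⟨hlt, hdisj⟩ := mem_colConfigs_iff.1 hγ
  -- every level is a strand end
  have hex : ∀ m : Level T, ∃ q ∈ γ, m = q.1 ∨ m = q.2 := by
    intro m
    have hm : m ∈ used γ := by
      rcases level_eq_in_or_out m with h | h
      · rw [h]; exact (hc.in_used _).2 (by simp [DiluteLink.occ])
      · rw [h]; exact (hc.out_used _).2 (by simp [DiluteLink.occ])
    rw [used, mem_biUnion] at hm
    obtain ⟨q, hq, hm⟩ := hm
    exact ⟨q, hq, by simpa using hm⟩
  -- hence every strand is a single edge
  have hadj : ∀ p ∈ γ, p.2.val = p.1.val + 1 := by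
    intro p hp
    have hp12 := hlt p hp
    rw [Fin.lt_def] at hp12
    by_contra hne
    obtain ⟨q, hq, hm⟩ := hex ⟨p.1.val + 1, by omega⟩
    have hq12 := hlt q hq
    rw [Fin.lt_def] at hq12
    have hqp : p ≠ q := by
      rintro rfl
      rcases hm with hm | hm <;> (have := congrArg Fin.val hm; simp only at this; omega)
    rcases hdisj p hp q hq hqp with h | h <;> rcases hm with hm | hm <;>
      (rw [Fin.lt_def] at h; have := congrArg Fin.val hm; simp only at this; omega)
  -- the rungs belong to `γ`, by induction on the node
  have hrung : ∀ k : ℕ, ∀ hk : k < T, (inLevel ⟨k, hk⟩, outLevel ⟨k, hk⟩) ∈ γ := by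
    intro k
    induction k with
    | zero =>
      intro hk
      obtain ⟨q, hq, hm⟩ := hex (inLevel ⟨0, hk⟩)
      have hq12 := hlt q hq
      rw [Fin.lt_def] at hq12
      have ha := hadj q hq
      rcases hm with hm | hm
      · have hv := congrArg Fin.val hm
        simp only [inLevel_val] at hv
        convert hq using 1
        exact Prod.ext hm (Fin.ext (by simp only [outLevel_val]; omega))
      · have hv := congrArg Fin.val hm
        simp only [inLevel_val] at hv
        omega
    | succ k ih =>
      intro hk
      have ih' := ih (by omega)
      obtain ⟨q, hq, hm⟩ := hex (inLevel ⟨k + 1, hk⟩)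
      have hq12 := hlt q hq
      rw [Fin.lt_def] at hq12
      have ha := hadj q hq
      rcases hm with hm | hm
      · have hv := congrArg Fin.val hm
        simp only [inLevel_val] at hv
        convert hq using 1
        exact Prod.ext hm (Fin.ext (by simp only [outLevel_val]; omega))
      · exfalso
        have hv := congrArg Fin.val hm
        simp only [inLevel_val] at hv
        have hne : (inLevel ⟨k, by omega⟩, outLevel ⟨k, by omega⟩) ≠ q := by
          intro h
          have := congrArg (fun p : Level T × Level T => p.2.val) h
          simp only [outLevel_val] at this
          omega
        rcases hdisj _ ih' q hq hne with h | h <;>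
          (rw [Fin.lt_def] at h; simp only [outLevel_val, inLevel_val] at h; omega)
  -- conclusion
  ext p
  constructor
  · intro hp
    by_contra hne'
    have hr : (inLevel (nodeOf p.1), outLevel (nodeOf p.1)) ∈ γ := hrung _ (nodeOf p.1).isLt
    have hne : p ≠ (inLevel (nodeOf p.1), outLevel (nodeOf p.1)) :=
      fun h => hne' (mem_rungs.2 ⟨_, h⟩)
    have hp12 := hlt p hp
    rw [Fin.lt_def] at hp12
    rcases hdisj p hp _ hr hne with h | h <;>
      (rw [Fin.lt_def] at h; simp only [outLevel_val, inLevel_val, nodeOf_val] at h; omega)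
  · intro hp
    obtain ⟨i, rfl⟩ := mem_rungs.1 hp
    exact hrung i.val i.isLt

/-- **The fully packed entry of the transfer matrix**: between the all-defect states (sector
`k = T`, `T` mutually avoiding through-lines filling the strip) the entry is `x^{2T}` — the
`T`-defect block is the `1 × 1` matrix `(x^{2T})`. [folklore] -/
theorem transferMatrix_full_full {R : Type*} [CommSemiring R] (n x : R) :
    transferMatrix R T n x (DiluteLink.full T) (DiluteLink.full T) = x ^ (2 * T) := by
  classical
  rw [transferMatrix_apply, sum_eq_single_of_mem (rungs T) rungs_mem_colConfigs]
  · rw [if_pos compatible_full_rungs, loops_full_rungs, verts_rungs]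
    simp
  · intro γ hγ hne
    rw [if_neg]
    exact fun hc => hne (eq_rungs_of_compatible hγ hc)

/-- A link state with `T` defects on `T` nodes is the all-defect state. [folklore] -/
theorem eq_full_of_defects_eq {σ : DiluteLink T} (h : σ.defects = T) : σ = DiluteLink.full T := by
  have hu : σ.defectSet = univ := eq_univ_of_card _ (by simpa [DiluteLink.defects] using h)
  refine DiluteLink.ext (funext fun i => ?_)
  have : i ∈ σ.defectSet := hu ▸ mem_univ i
  simpa [DiluteLink.IsDefect] using this

/-- Hence the `T`-defect sector has at most one element. [folklore] -/
instance instSubsingletonSectorTop : Subsingleton (DiluteLink.Sector T T) :=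
  ⟨fun a b => Subtype.ext ((eq_full_of_defects_eq a.2).trans (eq_full_of_defects_eq b.2).symm)⟩

/-- Powers of a matrix indexed by a one-element type. [folklore] -/
theorem pow_apply_of_subsingleton {ι R : Type*} [Fintype ι] [DecidableEq ι] [Subsingleton ι]
    [CommSemiring R] (M : Matrix ι ι R) (a : ι) (m : ℕ) : (M ^ m) a a = M a a ^ m := by
  induction m with
  | zero => simp
  | succ m ih => rw [pow_succ, Matrix.mul_apply, Fintype.sum_subsingleton _ a, ih, pow_succ]

/-- **The fully packed block and its powers**: `(sectorTM T T)^m = (x^{2Tm})` on the one-element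
sector. [folklore] -/
theorem sectorTM_top_pow_apply {R : Type*} [CommSemiring R] (n x : R) (m : ℕ)
    (a : DiluteLink.Sector T T) : (sectorTM R T T n x ^ m) a a = x ^ (2 * T * m) := by
  classical
  rw [pow_apply_of_subsingleton, sectorTM, submatrix_apply, eq_full_of_defects_eq a.2,
    transferMatrix_full_full, ← pow_mul]

/-! ### Width one: levels, link states, column configurations -/

namespace WidthOne

/-- Level `0` of the width-one strip (the vertex `U₀` of a column). [folklore] -/
def l0 : Level 1 := ⟨0, by norm_num⟩

/-- Level `1` of the width-one strip (the vertex `D₀` of a column). [folklore] -/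
def l1 : Level 1 := ⟨1, by norm_num⟩

/-- `l0` is level `0`. [folklore] -/
@[simp] theorem l0_val : l0.val = 0 := rfl

/-- `l1` is level `1`. [folklore] -/
@[simp] theorem l1_val : l1.val = 1 := rfl

/-- The two levels are distinct. [folklore] -/
theorem l0_ne_l1 : l0 ≠ l1 := by simp [Fin.ext_iff]

/-- The width-one strip has the two levels `l0, l1`. [folklore] -/
theorem level_eq (m : Level 1) : m = l0 ∨ m = l1 := by
  rcases m with ⟨v, hv⟩
  have : v = 0 ∨ v = 1 := by omega
  rcases this with rfl | rfl
  · exact Or.inl rfl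
  · exact Or.inr rfl

/-- The in-port of the unique node is level `0` (`U₀`). [folklore] -/
@[simp] theorem inLevel_zero : inLevel (0 : Fin 1) = l0 := Fin.ext (by simp)

/-- The out-port of the unique node is level `1` (`D₀`). [folklore] -/
@[simp] theorem outLevel_zero : outLevel (0 : Fin 1) = l1 := Fin.ext (by simp)

/-- On one node a link state is the vacuum or the single defect (an arc needs two nodes). [folklore] -/
theorem diluteLink_eq (σ : DiluteLink 1) : σ = DiluteLink.vacuum 1 ∨ σ = DiluteLink.single 0 := by
  rcases h : σ.slot 0 with _ | _ | j
  · left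
    refine DiluteLink.ext (funext fun k => ?_)
    rw [Fin.eq_zero k, h]
    rfl
  · right
    refine DiluteLink.ext (funext fun k => ?_)
    rw [Fin.eq_zero k, h]
    simp
  · exact absurd (Subsingleton.elim 0 j) (DiluteLink.ne_of_slot_eq_arc h)

/-- The one-defect sector on one node is the single defect. [folklore] -/
theorem sector_one_eq (τ : DiluteLink.Sector 1 1) : τ = DiluteLink.Sector.single 0 := by
  rcases τ with ⟨τ, hτ⟩
  rcases diluteLink_eq τ with rfl | rfl
  · simp at hτ
  · rfl

/-- Hence the one-defect sector on one node has at most one element. [folklore] -/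
instance instSubsingletonSector : Subsingleton (DiluteLink.Sector 1 1) :=
  ⟨fun a b => (sector_one_eq a).trans (sector_one_eq b).symm⟩

/-- The node of the single defect is occupied. [folklore] -/
@[simp] theorem single_occ : (DiluteLink.single (0 : Fin 1)).occ 0 := by
  simp [DiluteLink.occ]

/-- The node of the single defect is a defect. [folklore] -/
@[simp] theorem single_isDefect : (DiluteLink.single (0 : Fin 1)).IsDefect 0 := by
  simp [DiluteLink.IsDefect]

/-- The single defect has no arc. [folklore] -/
theorem single_slot_ne_arc (e f : Fin 1) : (DiluteLink.single (0 : Fin 1)).slot e ≠ .arc f := by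
  rw [Fin.eq_zero e]
  simp

/-- The only possible strand of a width-one column is the rung `U₀ — D₀`. [folklore] -/
theorem strands_one : strands 1 = {(l0, l1)} := by
  ext ⟨a, b⟩
  simp only [strands, mem_filter, mem_univ, true_and, mem_singleton, Prod.mk.injEq]
  rcases level_eq a with rfl | rfl <;> rcases level_eq b with rfl | rfl <;> decide

/-- The column configurations at width one: empty, or the rung. [folklore] -/
theorem colConfigs_one : colConfigs 1 = {∅, {(l0, l1)}} := by
  ext γ
  simp only [colConfigs, strands_one, mem_filter, mem_powerset, subset_singleton_iff, mem_insert,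
    mem_singleton]
  constructor
  · exact fun h => h.1
  · rintro (rfl | rfl)
    · simp
    · simp

/-- The two width-one column configurations are distinct. [folklore] -/
theorem empty_ne_rung : (∅ : Finset (Level 1 × Level 1)) ≠ {(l0, l1)} :=
  (singleton_ne_empty _).symm

/-- The empty configuration uses no port. [folklore] -/
@[simp] theorem used_empty : used (∅ : Finset (Level 1 × Level 1)) = ∅ := by simp [used]

/-- The rung uses both ports. [folklore] -/
@[simp] theorem used_rung : used ({(l0, l1)} : Finset (Level 1 × Level 1)) = {l0, l1} := by
  simp [used]

/-- The empty configuration visits no vertex. [folklore] -/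
@[simp] theorem verts_empty : verts (∅ : Finset (Level 1 × Level 1)) = 0 := by simp [verts]

/-- The rung visits the two vertices `U₀, D₀`. [folklore] -/
@[simp] theorem verts_rung : verts ({(l0, l1)} : Finset (Level 1 × Level 1)) = 2 := by
  simp [verts]

/-- The half-strands at width one. [folklore] -/
theorem halfStrands_one :
    halfStrands 1 = {(l0, l0, true), (l1, l1, true), (l0, l1, true), (l0, l1, false)} := by
  ext ⟨a, b, t⟩
  simp only [halfStrands, mem_filter, mem_univ, true_and, mem_insert, mem_singleton, Prod.mk.injEq]
  rcases level_eq a with rfl | rfl <;> rcases level_eq b with rfl | rfl <;> cases t <;> decide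

/-! ### Width one: the glued graphs -/

/-- No arcs on one node: the `arcN` vertices of a width-one glued graph are isolated. [folklore] -/
theorem not_adj_arcN (σ : DiluteLink 1) (γ : Finset (Level 1 × Level 1))
    (h : Option (Level 1 × Level 1 × Bool)) (q : Fin 1 × Fin 1) (w : Node 1) :
    ¬ (glue σ γ h).Adj (.arcN q) w :=
  not_adj_arcN_of_not_lt σ γ h (by rw [Fin.eq_zero q.1, Fin.eq_zero q.2]; exact lt_irrefl _) w

/-- In the rung column (no half-strand) the neighbours of a port are exactly the rung. [folklore] -/
theorem rung_adj_port_iff (σ : DiluteLink 1) (m : Level 1) (w : Node 1) :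
    (glue σ {(l0, l1)} none).Adj (.port m) w ↔ w = .strand (l0, l1) := by
  have hq : ∀ q : Fin 1 × Fin 1, ¬ q.1 < q.2 := fun q => by
    rw [Fin.eq_zero q.1, Fin.eq_zero q.2]; exact lt_irrefl _
  rw [glue, SimpleGraph.fromRel_adj]
  cases w with
  | port m' => simp [glueRel]
  | strand p =>
    simp only [ne_eq, reduceCtorEq, not_false_eq_true, true_and, glueRel, mem_singleton,
      Node.strand.injEq, or_false]
    constructor
    · exact fun h => h.1
    · rintro rfl
      exact ⟨rfl, by rcases level_eq m with rfl | rfl <;> simp⟩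
  | arcN q => simp [glueRel, hq q]
  | half => simp [glueRel]
  | term => simp [glueRel]

/-- Hence in the rung column the two ports are joined through the rung. [folklore] -/
theorem rung_reachable_ports (σ : DiluteLink 1) (m m' : Level 1) :
    (glue σ {(l0, l1)} none).Reachable (.port m) (.port m') := by
  have h1 : (glue σ {(l0, l1)} none).Adj (.port m) (.strand (l0, l1)) :=
    (rung_adj_port_iff σ m _).2 rfl
  have h2 : (glue σ {(l0, l1)} none).Adj (.port m') (.strand (l0, l1)) :=
    (rung_adj_port_iff σ m' _).2 rfl
  exact h1.reachable.trans h2.symm.reachable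

/-- The rung column closes no loop. [folklore] -/
theorem loops_rung (σ : DiluteLink 1) : loops (glue σ {(l0, l1)} none) = 0 := by
  refine loops_eq_zero fun v => ?_
  have hport : ∀ m, ¬ IsLoop (glue σ {(l0, l1)} none)
      ((glue σ {(l0, l1)} none).connectedComponentMk (.port m)) :=
    fun m => not_isLoop_of_adj_iff_eq _ _ (rung_adj_port_iff σ m)
  cases v with
  | port m => exact hport m
  | strand p =>
    by_cases hp : p = (l0, l1)
    · subst hp
      exact not_isLoop_of_adj ((rung_adj_port_iff σ l0 _).2 rfl) (hport l0)
    · exact not_isLoop_of_not_adj _ (not_adj_strand_of_notMem σ none (by simpa using hp))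
  | arcN q => exact not_isLoop_of_not_adj _ (not_adj_arcN σ _ none q)
  | half => exact not_isLoop_of_not_adj _ (not_adj_half_none σ _)
  | term => exact not_isLoop_of_not_adj _ (not_adj_term_none σ _)

/-- In a boundary column with the empty configuration and a half-strand with port end `m₀`, the
neighbours of a port. [folklore] -/
theorem half_adj_port_iff (σ : DiluteLink 1) (hs : Level 1 × Level 1 × Bool) (m : Level 1) (w : Node 1) :
    (glue σ ∅ (some hs)).Adj (.port m) w ↔ w = .half ∧ m = portEnd hs := by
  have hq : ∀ q : Fin 1 × Fin 1, ¬ q.1 < q.2 := fun q => by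
    rw [Fin.eq_zero q.1, Fin.eq_zero q.2]; exact lt_irrefl _
  rw [glue, SimpleGraph.fromRel_adj]
  cases w with
  | port m' => simp [glueRel]
  | strand p => simp [glueRel]
  | arcN q => simp [glueRel, hq q]
  | half => simp [glueRel]
  | term => simp [glueRel]

/-- … the neighbours of `half`: its port end and the terminal. [folklore] -/
theorem half_adj_half_iff (σ : DiluteLink 1) (hs : Level 1 × Level 1 × Bool) (w : Node 1) :
    (glue σ ∅ (some hs)).Adj .half w ↔ w = .port (portEnd hs) ∨ w = .term := by
  rw [glue, SimpleGraph.fromRel_adj]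
  cases w with
  | port m' =>
    simp only [ne_eq, reduceCtorEq, not_false_eq_true, true_and, glueRel, Option.some.injEq,
      exists_eq_left', false_or, Node.port.injEq, or_false]
  | strand p => simp [glueRel]
  | arcN q => simp [glueRel]
  | half => simp [glueRel]
  | term => simp [glueRel]

/-- … the neighbours of the terminal: `half` only. [folklore] -/
theorem half_adj_term_iff (σ : DiluteLink 1) (hs : Level 1 × Level 1 × Bool) (w : Node 1) :
    (glue σ ∅ (some hs)).Adj .term w ↔ w = .half := by
  rw [glue, SimpleGraph.fromRel_adj]
  cases w <;> simp [glueRel]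

/-- … so the port end of the half-strand reaches the terminal. [folklore] -/
theorem half_reachable_term (σ : DiluteLink 1) (hs : Level 1 × Level 1 × Bool) :
    (glue σ ∅ (some hs)).Reachable (.port (portEnd hs)) .term := by
  have h1 : (glue σ ∅ (some hs)).Adj (.port (portEnd hs)) .half :=
    (half_adj_port_iff σ hs _ _).2 ⟨rfl, rfl⟩
  have h2 : (glue σ ∅ (some hs)).Adj .half .term := (half_adj_half_iff σ hs _).2 (Or.inr rfl)
  exact h1.reachable.trans h2.reachable

/-- … and no loop is closed. [folklore] -/
theorem loops_half (σ : DiluteLink 1) (hs : Level 1 × Level 1 × Bool) :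
    loops (glue σ ∅ (some hs)) = 0 := by
  refine loops_eq_zero fun v => ?_
  have hterm : ¬ IsLoop (glue σ ∅ (some hs)) ((glue σ ∅ (some hs)).connectedComponentMk .term) :=
    not_isLoop_of_adj_iff_eq _ _ (half_adj_term_iff σ hs)
  have hhalf : ¬ IsLoop (glue σ ∅ (some hs)) ((glue σ ∅ (some hs)).connectedComponentMk .half) :=
    not_isLoop_of_adj ((half_adj_term_iff σ hs _).2 rfl) hterm
  cases v with
  | port m =>
    by_cases hm : m = portEnd hs
    · exact not_isLoop_of_adj ((half_adj_half_iff σ hs _).2 (Or.inl (by rw [hm]))) hhalf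
    · exact not_isLoop_of_not_adj _ fun w hw => hm ((half_adj_port_iff σ hs m w).1 hw).2
  | strand p => exact not_isLoop_of_not_adj _ (not_adj_strand_of_notMem σ _ (by simp))
  | arcN q => exact not_isLoop_of_not_adj _ (not_adj_arcN σ _ _ q)
  | half => exact hhalf
  | term => exact hterm

/-! ### Width one: compatibility -/

/-- The rung is compatible with the defect on both cuts. [folklore] -/
theorem compatible_rung :
    Compatible (DiluteLink.single (0 : Fin 1)) {(l0, l1)} (DiluteLink.single 0) where
  in_used i := by rw [Fin.eq_zero i]; simp
  out_used e := by rw [Fin.eq_zero e]; simp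
  defects_apart i j _ _ hij := absurd (Subsingleton.elim i j) hij
  arc_iff e f := by
    simp only [single_slot_ne_arc, false_iff, not_and]
    exact fun hef => absurd (Subsingleton.elim e f) hef
  defect_iff e := by
    rw [Fin.eq_zero e]
    simp only [single_isDefect, true_iff]
    exact ⟨0, single_isDefect, by simpa using rung_reachable_ports _ l1 l0⟩
  through i hi := ⟨0, rung_reachable_ports _ _ _⟩

/-- The empty column is not compatible with an occupied in-port. [folklore] -/
theorem not_compatible_empty (τ : DiluteLink 1) :
    ¬ Compatible (DiluteLink.single (0 : Fin 1)) ∅ τ := fun h => by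
  simpa using (h.in_used 0).2 single_occ

/-- Start columns: the half-strand must end at the out-port `l1`; then the empty configuration is
compatible with the outgoing defect. [folklore] -/
theorem startCompatible_iff (hs : Level 1 × Level 1 × Bool) :
    StartCompatible ∅ hs (DiluteLink.single (0 : Fin 1)) ↔ portEnd hs = l1 := by
  constructor
  · intro h
    rcases level_eq (portEnd hs) with h0 | h1
    · exact absurd h0.symm (by simpa using (h.no_in 0).2)
    · exact h1
  · intro h
    exact
      { disjoint := fun p hp => by simp at hp
        no_in := fun i => by rw [Fin.eq_zero i, h]; simp [l0_ne_l1]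
        out_used := fun e => by rw [Fin.eq_zero e, h]; simp
        arc_iff := fun e f => by
          simp only [single_slot_ne_arc, false_iff, not_and]
          exact fun hef => absurd (Subsingleton.elim e f) hef
        defect_iff := fun e => by
          rw [Fin.eq_zero e]
          simp only [single_isDefect, true_iff, outLevel_zero, ← h]
          exact half_reachable_term _ hs
        start_defect := fun e _ => by rw [Fin.eq_zero e]; exact single_isDefect }

/-- A start column cannot contain the rung (it would use the closed in-port). [folklore] -/
theorem not_startCompatible_rung (hs : Level 1 × Level 1 × Bool) (τ : DiluteLink 1) :
    ¬ StartCompatible {(l0, l1)} hs τ := fun h => by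
  simpa using (h.no_in 0).1

/-- End columns: the half-strand must end at the in-port `l0`; then the empty configuration is
compatible with the incoming defect. [folklore] -/
theorem endCompatible_iff (hs : Level 1 × Level 1 × Bool) :
    EndCompatible (DiluteLink.single (0 : Fin 1)) ∅ hs ↔ portEnd hs = l0 := by
  constructor
  · intro h
    have := (h.in_used 0).2 single_occ
    simpa [eq_comm] using this
  · intro h
    exact
      { disjoint := fun p hp => by simp at hp
        no_out := fun e => by rw [Fin.eq_zero e, h]; simp [l0_ne_l1.symm]
        in_used := fun i => by rw [Fin.eq_zero i, h]; simp
        defects_apart := fun i j _ _ hij => absurd (Subsingleton.elim i j) hij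
        through := fun i _ => by
          rw [Fin.eq_zero i, inLevel_zero, ← h]
          exact half_reachable_term _ hs
        term_defect := ⟨0, single_isDefect, by
          rw [inLevel_zero, ← h]
          exact half_reachable_term _ hs⟩ }

/-- An end column cannot contain the rung (it would use the closed out-port). [folklore] -/
theorem not_endCompatible_rung (σ : DiluteLink 1) (hs : Level 1 × Level 1 × Bool) :
    ¬ EndCompatible σ {(l0, l1)} hs := fun h => by
  simpa using (h.no_out 0).1

end WidthOne

/-! ### Width one: the closed forms -/

open WidthOne

open scoped Classical in
/-- **Width one, one defect**: the entry of the transfer matrix between the single-defect states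
is `x²` (the rung `U₀ — D₀`: two vertices, no loop). [folklore] -/
theorem transferMatrix_one_single_single {R : Type*} [CommSemiring R] (n x : R) :
    transferMatrix R 1 n x (DiluteLink.single 0) (DiluteLink.single 0) = x ^ 2 := by
  rw [transferMatrix_apply, colConfigs_one, sum_pair empty_ne_rung, if_neg (not_compatible_empty _),
    if_pos compatible_rung, loops_rung, verts_rung]
  simp

/-- The two link states on one node are distinct. [folklore] -/
theorem WidthOne.vacuum_ne_single : DiluteLink.vacuum 1 ≠ DiluteLink.single (0 : Fin 1) := fun h => by
  simpa using congrArg DiluteLink.defects h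

/-- **The width-one transfer matrix** is `diag(1, x²)` on (vacuum, single defect). [folklore] -/
theorem transferMatrix_one {R : Type*} [CommSemiring R] (n x : R) :
    transferMatrix R 1 n x =
      Matrix.diagonal fun σ => if σ = DiluteLink.vacuum 1 then 1 else x ^ 2 := by
  ext τ σ
  rcases diluteLink_eq τ with rfl | rfl <;> rcases diluteLink_eq σ with rfl | rfl
  · rw [transferMatrix_vacuum_vacuum, Matrix.diagonal_apply_eq, if_pos rfl]
  · rw [transferMatrix_apply_of_defects_ne n x (by simp), Matrix.diagonal_apply_ne _ vacuum_ne_single]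
  · rw [transferMatrix_apply_of_defects_ne n x (by simp),
      Matrix.diagonal_apply_ne _ vacuum_ne_single.symm]
  · rw [transferMatrix_one_single_single, Matrix.diagonal_apply_eq, if_neg vacuum_ne_single.symm]

open scoped Classical in
/-- **Width one, initial vector**: `sawIn 1 x (single 0) = x + x²` (start at `D₀` and leave, or
start at `U₀` and run the rung). [folklore] -/
theorem sawIn_one_single {R : Type*} [CommSemiring R] (x : R) :
    sawIn R 1 x (DiluteLink.single 0) = x + x ^ 2 := by
  simp only [sawIn, colConfigs_one, sum_pair empty_ne_rung, if_neg (not_startCompatible_rung _ _),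
    sum_const_zero, add_zero, halfStrands_one, startCompatible_iff]
  rw [sum_insert (by decide), sum_insert (by decide), sum_insert (by decide), sum_singleton]
  simp [portEnd, hverts, l0_ne_l1]

open scoped Classical in
/-- **Width one, final covector**: `sawOut 1 n x (single 0) = x + x²`. [folklore] -/
theorem sawOut_one_single {R : Type*} [CommSemiring R] (n x : R) :
    sawOut R 1 n x (DiluteLink.single 0) = x + x ^ 2 := by
  simp only [sawOut, colConfigs_one, sum_pair empty_ne_rung, if_neg (not_endCompatible_rung _ _),
    sum_const_zero, add_zero, halfStrands_one, endCompatible_iff, loops_half]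
  rw [sum_insert (by decide), sum_insert (by decide), sum_insert (by decide), sum_singleton]
  simp [portEnd, hverts, l0_ne_l1.symm]

/-- **Width one, the one-polymer strip partition function in closed form**:
`polymerPF 1 n x m = (x + x²)² · x^{2m}` — the hand count `W(1, m+1) = x^{2(m+1)} (1 + x)²` of
`x`-weighted self-avoiding walks from column `0` to column `m + 1` in the width-one strip (a path).
[folklore] -/
theorem polymerPF_one {R : Type*} [CommSemiring R] (n x : R) (m : ℕ) :
    polymerPF R 1 n x m = (x + x ^ 2) ^ 2 * x ^ (2 * m) := by
  rw [polymerPF_eq_sector, Fintype.sum_subsingleton _ (DiluteLink.Sector.single 0),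
    Fintype.sum_subsingleton _ (DiluteLink.Sector.single 0), pow_apply_of_subsingleton]
  simp only [sectorTM, submatrix_apply, DiluteLink.Sector.single]
  rw [transferMatrix_one_single_single, sawIn_one_single, sawOut_one_single]
  ring

end HexON

end Literature.Probability.LatticeModels

end
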